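import Mathlib
import Literature.Combinatorics.StablePolynomials.Basic
import HarnessLib

/-!
# Products of nonnegative linear forms: the row-form product of a doubly stochastic matrix

For a real matrix `A = (A i j)` (rows `i : ι`, columns `j : σ`) the **row-form product** is the
polynomial

  `p_A(z) = ∏_i (∑_j A i j · z_j) ∈ ℝ[z_j : j ∈ σ]`,

written here always literally as `∏ i, ∑ j, C (A i j) * X j : MvPolynomial σ ℝ` (no new
definition is introduced). This file records the elementary facts that make `p_A` the input of
Gurvits' capacity proof of the van der Waerden permanent bound (L. Gurvits, Electron. J. Combin. 15
(2008), R66): when the entries of `A` are nonnegative,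

* each row form `∑_j A i j z_j` with a positive coefficient is real stable
  (`isRealStable_linearForm`: on `Hⁿ` its imaginary part `∑_j A i j · Im z_j` is positive), hence
  so is `p_A` when every row sum is `1` (`isRealStable_prod_rowForms`,
  via `isUpperHalfPlaneStable_prod` of `Basic.lean`);
* `p_A` has nonnegative coefficients (`coeff_prod_rowForms_nonneg`);
* `p_A` has total degree at most the number of rows (`totalDegree_prod_rowForms_le`);
* `p_A(x) = ∏_i ∑_j A i j x_j` (`eval_prod_rowForms`), and if `A` is doubly stochastic then
  **`p_A` has capacity one**: `∏_j x_j ≤ p_A(x)` for all `x ≥ 0` (`prod_le_prod_rowSums`,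
  `prod_le_eval_prod_rowForms`) — row by row the weighted AM–GM inequality
  `∏_j x_j ^ (A i j) ≤ ∑_j A i j x_j` (Mathlib's `Real.geom_mean_le_arith_mean_weighted`), and
  `∏_i ∏_j x_j ^ (A i j) = ∏_j x_j ^ (∑_i A i j) = ∏_j x_j` by the column sums.

The conjunction of the four facts for a square doubly stochastic `A : Matrix (Fin n) (Fin n) ℝ` is
`Gurvits.prod_rowForms_doublyStochastic` (the form consumed on the summit side).

## Not in this file

The identification of the multilinear coefficient of `p_A` with the permanent of `A`, and
Gurvits' theorem itself (capacity lower bound for the mixed derivative of a stable polynomial with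
nonnegative coefficients) are separate files.

## Design / Mathlib

Mathlib has doubly stochastic matrices (`Matrix.doublyStochastic`, with
`Matrix.mem_doublyStochastic_iff_sum`) and the weighted AM–GM inequality, but no stable
polynomials; the hypotheses are kept as the three plain conditions (entries `≥ 0`, row sums `1`,
column sums `1`) in which `mem_doublyStochastic_iff_sum` unfolds membership, with rows and columns
indexed by arbitrary finite types where this costs nothing.

## References

* L. Gurvits, *Van der Waerden/Schrijver–Valiant like conjectures and stable (aka hyperbolic)
  homogeneous polynomials: one theorem for all*, Electron. J. Combin. 15 (2008), R66
  (arXiv:0711.3496), §4 (the polynomial `Prod_A` of a doubly stochastic matrix has capacity `1`).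
  [Gurvits2008]
-/

noncomputable section

open MvPolynomial Finset
open scoped BigOperators

namespace Literature.Combinatorics.StablePolynomials

variable {ι σ : Type*}

/-! ### Stability of nonnegative linear forms and of their products -/

/-- The imaginary part of a real linear form `∑_j a_j z_j` at a complex point is
`∑_j a_j · Im z_j`. [folklore] -/
theorem im_eval₂_linearForm [Fintype σ] (a : σ → ℝ) (z : σ → ℂ) :
    (MvPolynomial.eval₂ (algebraMap ℝ ℂ) z (∑ j, C (a j) * X j : MvPolynomial σ ℝ)).im =
      ∑ j, a j * (z j).im := by
  simp [MvPolynomial.eval₂_sum, Complex.im_sum, Complex.mul_im]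

/-- A linear form `∑_j a_j z_j` with nonnegative real coefficients, at least one of them positive,
is real stable: at a point of `Hⁿ` its imaginary part `∑_j a_j Im z_j ≥ a_{j₀} Im z_{j₀} > 0`.
[folklore] -/
theorem isRealStable_linearForm [Fintype σ] {a : σ → ℝ} (ha : ∀ j, 0 ≤ a j) (hpos : ∃ j, 0 < a j) :
    IsRealStable (∑ j, C (a j) * X j : MvPolynomial σ ℝ) := by
  rw [isRealStable_iff]
  intro z hz hzero
  obtain ⟨j₀, hj₀⟩ := hpos
  have hsum : 0 < ∑ j, a j * (z j).im :=
    lt_of_lt_of_le (mul_pos hj₀ (hz j₀))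
      (Finset.single_le_sum (f := fun j => a j * (z j).im)
        (fun j _ => mul_nonneg (ha j) (hz j).le) (Finset.mem_univ j₀))
  rw [← im_eval₂_linearForm a z, hzero] at hsum
  simp at hsum

/-- A row of a nonnegative matrix with row sum `1` has a positive entry. [folklore] -/
theorem exists_pos_of_sum_eq_one [Fintype σ] {a : σ → ℝ} (ha : ∀ j, 0 ≤ a j)
    (h1 : ∑ j, a j = 1) : ∃ j, 0 < a j := by
  obtain ⟨j, -, hj⟩ := Finset.exists_ne_zero_of_sum_ne_zero (h1.trans_ne one_ne_zero)
  exact ⟨j, (ha j).lt_of_ne (Ne.symm hj)⟩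

/-- **The row-form product of a row-stochastic matrix is real stable**: if `A i j ≥ 0` and every
row of `A` sums to `1`, then `p_A = ∏_i ∑_j A i j z_j` is real stable (a product of stable
polynomials, `isUpperHalfPlaneStable_prod`; for an empty row index the product is the stable
constant `1`). [folklore] -/
theorem isRealStable_prod_rowForms [Fintype ι] [Fintype σ] {A : Matrix ι σ ℝ}
    (hA : ∀ i j, 0 ≤ A i j) (hrow : ∀ i, ∑ j, A i j = 1) :
    IsRealStable (∏ i, ∑ j, C (A i j) * X j : MvPolynomial σ ℝ) := by
  unfold IsRealStable
  rw [map_prod]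
  exact isUpperHalfPlaneStable_prod _ fun i _ =>
    isRealStable_linearForm (hA i) (exists_pos_of_sum_eq_one (hA i) (hrow i))

/-! ### Nonnegative coefficients -/

/-- The product of finitely many polynomials with nonnegative real coefficients has nonnegative
coefficients (`coeff_mul` is a sum of products of coefficients). [folklore] -/
theorem coeff_prod_nonneg_of_coeff_nonneg {κ : Type*} (s : Finset κ) {f : κ → MvPolynomial σ ℝ}
    (hf : ∀ k ∈ s, ∀ m, 0 ≤ coeff m (f k)) (m : σ →₀ ℕ) : 0 ≤ coeff m (∏ k ∈ s, f k) := by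
  classical
  refine Finset.prod_induction f (fun q => ∀ m, 0 ≤ coeff m q) (fun p q hp hq m => ?_)
    (fun m => ?_) hf m
  · rw [coeff_mul]
    exact Finset.sum_nonneg fun x _ => mul_nonneg (hp x.1) (hq x.2)
  · rw [coeff_one]
    split_ifs <;> norm_num

/-- A linear form `∑_j a_j z_j` with nonnegative coefficients has nonnegative coefficients (its
coefficient at `z_j` is `a_j`, all others vanish). [folklore] -/
theorem coeff_linearForm_nonneg [Fintype σ] {a : σ → ℝ} (ha : ∀ j, 0 ≤ a j) (m : σ →₀ ℕ) :
    0 ≤ coeff m (∑ j, C (a j) * X j : MvPolynomial σ ℝ) := by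
  classical
  rw [coeff_sum]
  refine Finset.sum_nonneg fun j _ => ?_
  rw [coeff_C_mul, coeff_X]
  split_ifs
  · simpa using ha j
  · simp

/-- **The row-form product of a nonnegative matrix has nonnegative coefficients.** [folklore] -/
theorem coeff_prod_rowForms_nonneg [Fintype ι] [Fintype σ] {A : Matrix ι σ ℝ}
    (hA : ∀ i j, 0 ≤ A i j) (m : σ →₀ ℕ) :
    0 ≤ coeff m (∏ i, ∑ j, C (A i j) * X j : MvPolynomial σ ℝ) :=
  coeff_prod_nonneg_of_coeff_nonneg _ (fun i _ => coeff_linearForm_nonneg (hA i)) m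

/-! ### Total degree -/

/-- A linear form `∑_j a_j z_j` has total degree at most `1`. [folklore] -/
theorem totalDegree_linearForm_le [Fintype σ] (a : σ → ℝ) :
    (∑ j, C (a j) * X j : MvPolynomial σ ℝ).totalDegree ≤ 1 :=
  totalDegree_finsetSum_le fun j _ =>
    (totalDegree_mul _ _).trans (by rw [totalDegree_C, totalDegree_X])

/-- **The row-form product has total degree at most the number of rows.** [folklore] -/
theorem totalDegree_prod_rowForms_le [Fintype ι] [Fintype σ] (A : Matrix ι σ ℝ) :
    (∏ i, ∑ j, C (A i j) * X j : MvPolynomial σ ℝ).totalDegree ≤ Fintype.card ι :=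
  calc (∏ i, ∑ j, C (A i j) * X j : MvPolynomial σ ℝ).totalDegree
      ≤ ∑ i, (∑ j, C (A i j) * X j : MvPolynomial σ ℝ).totalDegree := totalDegree_finsetProd _ _
    _ ≤ ∑ _i : ι, 1 := Finset.sum_le_sum fun i _ => totalDegree_linearForm_le (A i)
    _ = Fintype.card ι := by simp

/-! ### Evaluation and capacity one -/

/-- `p_A(x) = ∏_i ∑_j A i j x_j`. [folklore] -/
theorem eval_prod_rowForms [Fintype ι] [Fintype σ] (A : Matrix ι σ ℝ) (x : σ → ℝ) :
    eval x (∏ i, ∑ j, C (A i j) * X j : MvPolynomial σ ℝ) = ∏ i, ∑ j, A i j * x j := by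
  simp only [map_prod, map_sum, map_mul, eval_C, eval_X]

/-- **Capacity one for doubly stochastic matrices** (Gurvits 2008: `Cap(Prod_A) = 1` when `A` is
doubly stochastic, where `Cap(p) = inf_{x > 0} p(x) / ∏ x_j`): if `A i j ≥ 0`, all row sums and
all column sums are `1`, then `∏_j x_j ≤ ∏_i ∑_j A i j x_j` for every `x ≥ 0`. Row by row this is
the weighted AM–GM inequality `∏_j x_j ^ (A i j) ≤ ∑_j A i j x_j`
(`Real.geom_mean_le_arith_mean_weighted`), and `∏_i ∏_j x_j ^ (A i j) = ∏_j x_j ^ (∑_i A i j) = ∏_j x_j`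
by the column sums. [cite: Gurvits2008, §4] -/
theorem prod_le_prod_rowSums [Fintype ι] [Fintype σ] {A : Matrix ι σ ℝ} (hA : ∀ i j, 0 ≤ A i j)
    (hrow : ∀ i, ∑ j, A i j = 1) (hcol : ∀ j, ∑ i, A i j = 1) {x : σ → ℝ} (hx : ∀ j, 0 ≤ x j) :
    ∏ j, x j ≤ ∏ i, ∑ j, A i j * x j := by
  have hgm : ∀ i, ∏ j, x j ^ A i j ≤ ∑ j, A i j * x j := fun i =>
    Real.geom_mean_le_arith_mean_weighted univ (A i) x (fun j _ => hA i j) (hrow i) fun j _ => hx j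
  calc ∏ j, x j = ∏ j, x j ^ (∑ i, A i j) := by simp [hcol]
    _ = ∏ i, ∏ j, x j ^ A i j := by
        rw [Finset.prod_comm]
        exact Finset.prod_congr rfl fun j _ => Real.rpow_sum_of_nonneg (hx j) fun i _ => hA i j
    _ ≤ ∏ i, ∑ j, A i j * x j :=
        Finset.prod_le_prod (fun i _ => Finset.prod_nonneg fun j _ => Real.rpow_nonneg (hx j) _)
          fun i _ => hgm i

/-- **Capacity one, polynomial form**: for a doubly stochastic `A` and `x ≥ 0`,
`∏_j x_j ≤ p_A(x)` with `p_A = ∏_i ∑_j A i j z_j`. [cite: Gurvits2008, §4] -/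
theorem prod_le_eval_prod_rowForms [Fintype ι] [Fintype σ] {A : Matrix ι σ ℝ}
    (hA : ∀ i j, 0 ≤ A i j) (hrow : ∀ i, ∑ j, A i j = 1) (hcol : ∀ j, ∑ i, A i j = 1)
    {x : σ → ℝ} (hx : ∀ j, 0 ≤ x j) :
    ∏ j, x j ≤ eval x (∏ i, ∑ j, C (A i j) * X j : MvPolynomial σ ℝ) := by
  rw [eval_prod_rowForms]
  exact prod_le_prod_rowSums hA hrow hcol hx

/-! ### The doubly stochastic package -/

namespace Gurvits

/-- **The row-form product of a doubly stochastic matrix** (the input of Gurvits' proof of the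
van der Waerden bound): for `A : Matrix (Fin n) (Fin n) ℝ` with nonnegative entries, row sums `1`
and column sums `1`, the polynomial `p_A = ∏_i ∑_j A i j z_j ∈ ℝ[z_0, …, z_{n-1}]` is real stable,
has nonnegative coefficients, has total degree `≤ n`, and satisfies `∏_j x_j ≤ p_A(x)` for all
`x > 0` (capacity one). [cite: Gurvits2008, §4] -/
theorem prod_rowForms_doublyStochastic :
    ∀ (n : ℕ) (A : Matrix (Fin n) (Fin n) ℝ), (∀ i j, 0 ≤ A i j) →
      (∀ i, ∑ j, A i j = 1) → (∀ j, ∑ i, A i j = 1) →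
      Literature.Combinatorics.StablePolynomials.IsRealStable
          (∏ i : Fin n, ∑ j : Fin n, MvPolynomial.C (A i j) * MvPolynomial.X j : MvPolynomial (Fin n) ℝ) ∧
      (∀ m, 0 ≤ MvPolynomial.coeff m (∏ i : Fin n, ∑ j : Fin n, MvPolynomial.C (A i j) * MvPolynomial.X j : MvPolynomial (Fin n) ℝ)) ∧
      (∏ i : Fin n, ∑ j : Fin n, MvPolynomial.C (A i j) * MvPolynomial.X j : MvPolynomial (Fin n) ℝ).totalDegree ≤ n ∧
      (∀ x : Fin n → ℝ, (∀ j, 0 < x j) →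
        ∏ j, x j ≤ MvPolynomial.eval x (∏ i : Fin n, ∑ j : Fin n, MvPolynomial.C (A i j) * MvPolynomial.X j)) :=
  fun _n _A hA hrow hcol =>
    ⟨isRealStable_prod_rowForms hA hrow, coeff_prod_rowForms_nonneg hA,
      (totalDegree_prod_rowForms_le _).trans (by simp),
      fun _x hx => prod_le_eval_prod_rowForms hA hrow hcol fun j => (hx j).le⟩

end Gurvits

end Literature.Combinatorics.StablePolynomials

end
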